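import Summits.BirchSwinnertonDyer.BirchSwinnertonDyer.Theses.PrintX8VS
import Summits.BirchSwinnertonDyer.BirchSwinnertonDyer.Theorems.PrintX8VSGlueRankLeOne
import Summits.BirchSwinnertonDyer.BirchSwinnertonDyer.Theorems.SignedLowerHalvesSprungLowerDivisibilityAtThreeRankCut
import HarnessLib

/-!
# Route `PrintX8VS`, W-82 «RANK CUT» (M1): the glue item `GlueSharpFlatMainConjectureOfKatoSporadicX8` — PROVED by composing
# p620968 (K_spor ∧ S4b-cyc ∧ S5 ⟹ K1≤1) with p625244 (K1≤1 ⟹ SPAN ⟹ … ⟹ C1)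

Landed by the LEAD of crux 19875 (`cruxlead-stmt-BirchSwinnertonDyer-19875` g4) on director-bsd (226), text = the x8 planner g31's
pre-written closer (rankcut-W82-g31/closers). HONEST FRAMING: pure plumbing, no new mathematics; K_spor (item 22569), S4b-cyc and K1 remain OPEN IN PRINT at a₃ = ±3;
BSD / the x8 leaf are not proved by this. Land with `ledger propose --kind proof --target
Summits/BirchSwinnertonDyer/BirchSwinnertonDyer/Theorems/PrintX8VSGlueSharpFlatMainConjectureOfKatoSporadicX8.lean --file <this>
--workitem <id of GlueSharpFlatMainConjectureOfKatoSporadicX8>` (text = x8 planner certificate rankcut-W82-g31/RankCutM1Sketch.lean §C).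
-/

set_option linter.dupNamespace false -- `…BirchSwinnertonDyer.BirchSwinnertonDyer…` is the cell's nested layout (D-0017)
set_option autoImplicit false

namespace Summit.BirchSwinnertonDyer.BirchSwinnertonDyer.Theorems.PrintX8VSGlueKatoSporadic

/-- **The W-82 rank-cut glue of route `PrintX8VS` holds** (item stmt-BirchSwinnertonDyer-22902
`GlueSharpFlatMainConjectureOfKatoSporadicX8`): K_spor (item 22569) → S4b-cyc (item 22901) → S5 held inputs (item 22571) → SPAN
(THEOREM B) → μ-transfer input → published bundle → C1 `SharpFlatMainConjectureX8` (typed at `r_an ≤ 1`), by composing p620968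
`ChromaticCommonZeros.lowerDivisibility_analyticRank_le_one_of_katoSporadic_of_posLevel` (K_spor ∧ S4b-cyc ∧ S5 ⟹ K1 cut to
`r_an ≤ 1`) with p625244 `PrintX8VSGlueRankLeOne.glueMainConjectureOfSpanX8RankLeOne_holds`. Unconditional as an implication;
closes the glue item only — K_spor, S4b-cyc, K1, the x8 leaf and BSD are NOT proved.
[cite: Kato2004Asterisque, Conj. 12.10 (p. 224)] [cite: Sprung2012, Thm. 7.14 (p. 1504), Prop. 7.19 and Main Conj. 7.21 (p. 1505)] -/
theorem glueSharpFlatMainConjectureOfKatoSporadicX8_holds :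
    Summit.BirchSwinnertonDyer.BirchSwinnertonDyer.Theses.PrintX8VS.GlueSharpFlatMainConjectureOfKatoSporadicX8 :=
  fun hK hC hH hSpan hIn hPub =>
    PrintX8VSGlueRankLeOne.glueMainConjectureOfSpanX8RankLeOne_holds
      (ChromaticCommonZeros.lowerDivisibility_analyticRank_le_one_of_katoSporadic_of_posLevel
        hK hC hH.1 hH.2.1 hH.2.2.1 hH.2.2.2.1 hH.2.2.2.2)
      hSpan hIn hPub

end Summit.BirchSwinnertonDyer.BirchSwinnertonDyer.Theorems.PrintX8VSGlueKatoSporadic
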